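import Summits.CriticalPhenomena.PercolationContinuityZ3.Theorems.PercNearOneGluingNoHeavyLowerTailSahiCombMixSingleOrMixed
import Summits.CriticalPhenomena.PercolationContinuityZ3.Theorems.PercNearOneGluingNoHeavyLowerTailSahiCombMixCaterpillar

/-!
# The comb hierarchy for Sahi's `E_k`, LXXV: READ-ONCE GADGET COROLLARIES of the single-OR mixed step (every `n`)

Support file of the one-cut programme (crux `NoHeavyLowerTail`, stmt-CriticalPhenomena-4575; cell `prim-masterthm`, seat P3, gen 12;
`run/shared/lean/prim/prim-masterthm/prim-masterthm-p3/HIERARCHY.md` §19(l), §20).  `…SahiCombMixSingleOrMixed` proved, for EVERY number `n` of members,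
that growth by mixed steps on pairwise distinct fresh coordinates, each OR-ing its coordinate into at most ONE member (AND-ing into any others), preserves the
hereditary comb class (`combHereditary_grow₂_single`, `combHereditary_decisionList_single`).  Combined with the read-once closure of the hereditary comb class
(`SahiCombHereditary.CombHereditary.readOnce`, `…SahiCombMixCaterpillar`; from `CombPos.readOnce`, `…SahiCombReadOnce`) the literals `{e ∈ ω}` may be replaced by
ARBITRARY increasing-or-not gadget events `G e ⊆ 2^ι`, each determined by its own block of coordinates (blocks = fibres of `π : ι → κ`):
* `combHereditary_grow₂_single_readOnce` — a `CombHereditary` start on the base cube `κ` grown by single-OR mixed steps, then read-once substituted;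
* `combHereditary_decisionList_single_readOnce` — from a constant start: every `n`-tuple of common-order read-once decision lists with at most one accepting
  literal per coordinate, with gadgets substituted for the literals, is hereditarily comb-positive on `2^ι`;
* `hereditaryAllOrders_decisionList_single(_readOnce)`, `sahiE_decisionList_single_readOnce_nonneg` — law-level shadows (every product measure, every row).
HONEST FRAMING: closure properties of the hereditary comb class; nothing here asserts (M⁺-k) or `C_k` for `k ≥ 3` in general. [this work]
-/

noncomputable section

open scoped Classical

namespace Summit.CriticalPhenomena.PercolationContinuityZ3.Theorems

open Finset Function
open Literature.Combinatorics.Sahi2008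
open Literature.Probability.Percolation (DeterminedBy)
open Literature.Probability.Percolation.DecisionTree (ind)
open SahiComb
open SahiCombHereditary (CombHereditary)

variable {ι : Type} [Fintype ι] {κ : Type} [Fintype κ]

namespace SahiCombMix

/-- **Growth by single-OR mixed steps, read-once substituted**: a `CombHereditary` family on the base cube `2^κ` determined by `S`, grown by mixed steps on pairwise
distinct coordinates outside `S` each OR-ing into at most one member, with every base coordinate `e` then replaced by a gadget `G e ⊆ 2^ι` determined by the fibre
`π⁻¹(e)`, is `CombHereditary` on `2^ι` — every `n`. [this work] -/
theorem combHereditary_grow₂_single_readOnce (π : ι → κ) (G : κ → Set (Set ι)) (hG : ∀ e, DeterminedBy (G e) {i | π i = e})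
    {n : ℕ} {U : Fin n → Set (Set κ)} {S : Set κ} (hUS : ∀ j, DeterminedBy (U j) S) (hU : CombHereditary U)
    (L : List (κ × (Fin n → Bool) × (Fin n → Bool))) (hL : (L.map Prod.fst).Nodup) (hS : ∀ s ∈ L, s.1 ∉ S)
    (h1 : ∀ s ∈ L, (∃ i, s.2.1 = sel i ∧ s.2.2 i = false) ∨ s.2.1 = fun _ => false) :
    CombHereditary (fun j => {ω : Set ι | {e | ω ∈ G e} ∈ grow₂ U L j}) :=
  (combHereditary_grow₂_single hUS hU L hL hS h1).readOnce π G hG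

/-- **Decision lists with at most one accepting literal per coordinate, read-once substituted**: from a constant start (member `j` is `Ω` if `c j`, else `∅`), any
list of mixed steps with pairwise distinct base coordinates each OR-ing into at most one member, with gadgets `G e ⊆ 2^ι` (determined by the fibres of `π`) substituted
for the literals, yields a `CombHereditary` family on `2^ι` — every `n`. [this work] -/
theorem combHereditary_decisionList_single_readOnce (π : ι → κ) (G : κ → Set (Set ι)) (hG : ∀ e, DeterminedBy (G e) {i | π i = e})
    {n : ℕ} (c : Fin n → Bool) (L : List (κ × (Fin n → Bool) × (Fin n → Bool))) (hL : (L.map Prod.fst).Nodup)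
    (h1 : ∀ s ∈ L, (∃ i, s.2.1 = sel i ∧ s.2.2 i = false) ∨ s.2.1 = fun _ => false) :
    CombHereditary (fun j => {ω : Set ι | {e | ω ∈ G e} ∈ grow₂ (fun j => bif c j then (Set.univ : Set (Set κ)) else ∅) L j}) :=
  (combHereditary_decisionList_single c L hL h1).readOnce π G hG

/-- Law-level shadow: every row of the ∩-closed family of such a decision-list family is nonnegative under every product measure. [this work] -/
theorem hereditaryAllOrders_decisionList_single {n : ℕ} (c : Fin n → Bool) (L : List (ι × (Fin n → Bool) × (Fin n → Bool)))
    (hL : (L.map Prod.fst).Nodup) (h1 : ∀ s ∈ L, (∃ i, s.2.1 = sel i ∧ s.2.2 i = false) ∨ s.2.1 = fun _ => false) (p : ι → unitInterval) :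
    SahiMixture.HereditaryAllOrders (bernoulliWeight p) (grow₂ (fun j => bif c j then (Set.univ : Set (Set ι)) else ∅) L) :=
  (combHereditary_decisionList_single c L hL h1).hereditaryAllOrders p

/-- Law-level shadow, read-once substituted: every row nonnegative under every product measure on `2^ι`. [this work] -/
theorem hereditaryAllOrders_decisionList_single_readOnce (π : ι → κ) (G : κ → Set (Set ι)) (hG : ∀ e, DeterminedBy (G e) {i | π i = e})
    {n : ℕ} (c : Fin n → Bool) (L : List (κ × (Fin n → Bool) × (Fin n → Bool))) (hL : (L.map Prod.fst).Nodup)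
    (h1 : ∀ s ∈ L, (∃ i, s.2.1 = sel i ∧ s.2.2 i = false) ∨ s.2.1 = fun _ => false) (p : ι → unitInterval) :
    SahiMixture.HereditaryAllOrders (bernoulliWeight p)
      (fun j => {ω : Set ι | {e | ω ∈ G e} ∈ grow₂ (fun j => bif c j then (Set.univ : Set (Set κ)) else ∅) L j}) :=
  (combHereditary_decisionList_single_readOnce π G hG c L hL h1).hereditaryAllOrders p

/-- In particular `E_m ≥ 0` for every multiset of members of a read-once substituted decision-list family with at most one accepting literal per coordinate,
under every product measure. [this work] -/
theorem sahiE_decisionList_single_readOnce_nonneg (π : ι → κ) (G : κ → Set (Set ι)) (hG : ∀ e, DeterminedBy (G e) {i | π i = e})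
    {n : ℕ} (c : Fin n → Bool) (L : List (κ × (Fin n → Bool) × (Fin n → Bool))) (hL : (L.map Prod.fst).Nodup)
    (h1 : ∀ s ∈ L, (∃ i, s.2.1 = sel i ∧ s.2.2 i = false) ∨ s.2.1 = fun _ => false) (p : ι → unitInterval) (m : ℕ) (s : Fin m → Fin n) :
    0 ≤ sahiE (bernoulliWeight p) m
      (fun j => ind {ω : Set ι | {e | ω ∈ G e} ∈ grow₂ (fun j => bif c j then (Set.univ : Set (Set κ)) else ∅) L (s j)}) :=
  ((combHereditary_decisionList_single_readOnce π G hG c L hL h1).combAllOrders m s).nonneg p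

end SahiCombMix

end Summit.CriticalPhenomena.PercolationContinuityZ3.Theorems

end
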